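import Literature.Geometry.Lorentzian.RicciChartDecay
import Literature.Geometry.Lorentzian.RicciVariationSteps
import Literature.Geometry.Lorentzian.CoordScalarJet
import Literature.Geometry.Lorentzian.ChartMetricCoord
import HarnessLib

/-!
# Uniform decay `|R_t − R| ≤ C |t| r⁻⁴` of the scalar curvatures of `ds²_t = ds² + t Ric` on the end
# (Schoen–Yau 1979, (3.28)–(3.29))

Schoen–Yau, Comm. Math. Phys. 65 (1979), p. 73: along the family `ds²_t = ds² + t Ric` of the
proof of Thm. 2 the scalar curvatures `R_t` satisfy the hypotheses (3.3) of Lemma 3.2 *uniformly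
for `t` small*, and the difference quotients `(R_t − R₀)/t` are dominated ((3.28)–(3.29)), which
is what the differentiation of the mass integral (3.27)–(3.30) under the integral sign requires.
This file proves the far-region half of that statement: for data with `h − δ = o₅(r⁻²)` on the
end there are `R₁ > R` and `K` such that for every `|t| ≤ 1` and all data `D₂` with metric
`h + t Ric(h)` pointwise,

  `|R(D₂)(Φ y) − R(h)(Φ y)| ≤ |t| · K · ‖y‖⁻⁴`   for `‖y‖ ≥ R₁`

(`AFEnd.exists_far_abs_scalarCurvature_ricciFamily_sub_le`). *Mechanism* (`CoordScalarJet.lean`):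
in the chart of the end the scalar curvature is a fixed smooth function `𝓢` of the 2-jet of the
components (`scalAt_eq_scalarJet`, `contDiffOn_scalarJet`), the components of `ds²_t` are affine
in `t`, `hCoeff e D₂ = hCoeff e D + t · ricciCoeff e D` (`hCoeff_eq_add_ricciCoeff`), so the 2-jet
moves along the segment `J_h(y) + t J_Ric(y)`; `J_h(y) → (δ, 0, 0)` (`h − δ = O₂(r⁻²)`) and
`‖J_Ric(y)‖ ≤ K₁ ‖y‖⁻⁴` (`ricciCoeff ∈ O₃(r⁻⁴)`, `isBigOSmooth_ricciCoeff`), so for `‖y‖` large and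
`|t| ≤ 1` the segment stays in a fixed compact convex neighbourhood of `(δ, 0, 0)` on which `𝓢` is
Lipschitz (`exists_bound_sub_le_mul_norm_sub_of_contDiffOn`). Auxiliary results: the scalar
curvature of data read in the chart of the end is `scalAt` of `hCoeff` (`scalAt_hCoeff_eq`), and the
first two derivatives of `hCoeff e D₂` on the far region (`fderiv_hCoeff_ricciFamily`,
`fderiv_fderiv_hCoeff_ricciFamily`). All results are proved; no definitions, no named facts.

## References

* R. Schoen, S.-T. Yau, *On the proof of the positive mass conjecture in general relativity*,
  Comm. Math. Phys. 65 (1979) 45–76, §3: (3.3), the family `ds²_t` (p. 72), (3.27)–(3.29) (p. 73).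
-/

noncomputable section

set_option maxSynthPendingDepth 4
set_option synthInstance.maxHeartbeats 100000
set_option maxHeartbeats 400000

open Set Function Filter Metric Bornology Asymptotics TopologicalSpace Manifold Bundle
open scoped Topology ContDiff Manifold

namespace Literature.Geometry.Lorentzian

namespace AFEnd

variable {X : Type} [TopologicalSpace X] [ChartedSpace E3 X] [IsManifold (𝓡 3) ∞ X]
  (e : AFEnd X) (D : InitialDataSet (𝓡 3) X)

/-! ### The scalar curvature of data read in the chart of the end -/

/-- The chart components of any data are smooth, symmetric and nondegenerate metric components
on the exterior region (`OpensChart.isMetricOn_repr` for the pullback metric, whose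
representative is `hCoeff`, `val_comap_dataChart`). [folklore] -/
theorem isMetricOn_hCoeff (D₂ : InitialDataSet (𝓡 3) X) :
    MetricCoord.IsMetricOn (hCoeff e D₂) {y : E3 | e.R < ‖y‖} :=
  OpensChart.isMetricOn_repr (e.val_comap_dataChart D₂)

/-- **The scalar curvature read in the chart of the end is `scalAt` of the chart components**:
`S(hCoeff e D₂)(y) = R(D₂)(Φ y)` for `R < ‖y‖` (naturality `scalarCurvatureCoeff_eq_comap` and
`OpensChart.scalarCurvature_eq_scalAt`). [cite: ONeill1983, Ch. 3, Prop. 3.59 and Def. 3.53] -/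
theorem scalAt_hCoeff_eq (D₂ : InitialDataSet (𝓡 3) X) {y : E3} (hy : e.R < ‖y‖) :
    MetricCoord.scalAt (hCoeff e D₂) y = D₂.scalarCurvatureFn (e.dataChart ⟨y, hy⟩) := by
  haveI := D₂.metric.hasLeviCivita
  haveI := (D₂.metric.comap PseudoRiemannianMetric.contMDiff_pullbackBilin_holds e.dataChart
    e.contMDiff_dataChart_succ e.injective_mfderiv_dataChart rfl).hasLeviCivita
  have h1 : scalarCurvatureCoeff e D₂ y = D₂.scalarCurvatureFn (e.dataChart ⟨y, hy⟩) := by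
    rw [InitialDataSet.scalarCurvatureFn_eq, scalarCurvatureCoeff, dif_pos hy]
  rw [← h1, e.scalarCurvatureCoeff_eq_comap D₂ hy,
    OpensChart.scalarCurvature_eq_scalAt (e.val_comap_dataChart D₂) ⟨y, hy⟩]

/-! ### The jets of `hCoeff e D₂ = hCoeff e D + t · ricciCoeff e D` -/

section Jets

variable [D.metric.HasLeviCivita] {D₂ : InitialDataSet (𝓡 3) X} {t : ℝ}
  (hD₂ : ∀ (x : X) (v w : TangentSpace (𝓡 3) x),
    D₂.metric.val x v w = D.metric.val x v w + t * D.metric.ricci x v w)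
include hD₂

/-- The chart components of `D₂` as a function: `hCoeff e D₂ = hCoeff e D + t • ricciCoeff e D`.
[cite: SchoenYauPMT1979, §3 p. 72] -/
theorem hCoeff_ricciFamily_eq :
    hCoeff e D₂ = fun y ↦ hCoeff e D y + t • ricciCoeff e D y :=
  funext fun y ↦ e.hCoeff_eq_add_ricciCoeff D hD₂ y

/-- **First derivative of the components of `ds²_t`**: on an open far region where `ricciCoeff`
is smooth, `D(hCoeff e D₂)(y) = D(hCoeff e D)(y) + t · D(ricciCoeff e D)(y)`. [folklore] -/
theorem fderiv_hCoeff_ricciFamily {R₀ : ℝ} (hR₀ : e.R ≤ R₀)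
    (hP : ContDiffOn ℝ ∞ (ricciCoeff e D) {y : E3 | R₀ < ‖y‖}) {y : E3} (hy : R₀ < ‖y‖) :
    fderiv ℝ (hCoeff e D₂) y = fderiv ℝ (hCoeff e D) y + t • fderiv ℝ (ricciCoeff e D) y := by
  have hHd : DifferentiableAt ℝ (hCoeff e D) y :=
    (e.contDiffAt_hCoeff D (hR₀.trans_lt hy)).differentiableAt (by simp)
  have hPd : DifferentiableAt ℝ (ricciCoeff e D) y :=
    ((hP y hy).contDiffAt ((isOpen_setOf_lt_norm R₀).mem_nhds hy)).differentiableAt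
      (by simp)
  rw [e.hCoeff_ricciFamily_eq D hD₂,
    fderiv_fun_add (g := fun y ↦ t • ricciCoeff e D y) hHd (hPd.const_smul t), fderiv_fun_const_smul hPd]

/-- **Second derivative of the components of `ds²_t`**:
`D²(hCoeff e D₂)(y) = D²(hCoeff e D)(y) + t · D²(ricciCoeff e D)(y)` on an open far region where
`ricciCoeff` is smooth. [folklore] -/
theorem fderiv_fderiv_hCoeff_ricciFamily {R₀ : ℝ} (hR₀ : e.R ≤ R₀)
    (hP : ContDiffOn ℝ ∞ (ricciCoeff e D) {y : E3 | R₀ < ‖y‖}) {y : E3} (hy : R₀ < ‖y‖) :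
    fderiv ℝ (fderiv ℝ (hCoeff e D₂)) y =
      fderiv ℝ (fderiv ℝ (hCoeff e D)) y + t • fderiv ℝ (fderiv ℝ (ricciCoeff e D)) y := by
  have hΩ : IsOpen {y : E3 | R₀ < ‖y‖} := isOpen_setOf_lt_norm R₀
  have hH : ContDiffOn ℝ ∞ (hCoeff e D) {y : E3 | R₀ < ‖y‖} := fun z hz ↦
    (e.contDiffAt_hCoeff D (hR₀.trans_lt hz)).contDiffWithinAt
  have hHd : DifferentiableAt ℝ (fderiv ℝ (hCoeff e D)) y :=
    ((hH.fderiv_of_isOpen (m := ∞) hΩ le_rfl y hy).contDiffAt (hΩ.mem_nhds hy)).differentiableAt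
      (by simp)
  have hPd : DifferentiableAt ℝ (fderiv ℝ (ricciCoeff e D)) y :=
    ((hP.fderiv_of_isOpen (m := ∞) hΩ le_rfl y hy).contDiffAt (hΩ.mem_nhds hy)).differentiableAt
      (by simp)
  have hev : fderiv ℝ (hCoeff e D₂) =ᶠ[𝓝 y]
      fun z ↦ fderiv ℝ (hCoeff e D) z + t • fderiv ℝ (ricciCoeff e D) z := by
    filter_upwards [hΩ.mem_nhds hy] with z hz
    exact e.fderiv_hCoeff_ricciFamily D hD₂ hR₀ hP hz
  rw [hev.fderiv_eq, fderiv_fun_add (g := fun z ↦ t • fderiv ℝ (ricciCoeff e D) z) hHd (hPd.const_smul t),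
    fderiv_fun_const_smul hPd]

end Jets

/-! ### Uniform decay of `R_t − R` on the end -/

/-- A symbol estimate in bound form: if `f = O(‖y‖^a)` along `cobounded` for a nonnegative
real function `f`, there are `C ≥ 0` and a radius beyond which `f y ≤ C ‖y‖^a`. [folklore] -/
private theorem exists_radius_le_of_isBigO {f : E3 → ℝ} {a : ℝ}
    (h : f =O[cobounded E3] fun y ↦ ‖y‖ ^ a) :
    ∃ C r : ℝ, 0 ≤ C ∧ ∀ y : E3, r ≤ ‖y‖ → f y ≤ C * ‖y‖ ^ a := by
  obtain ⟨C, hC0, hC⟩ := h.exists_nonneg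
  obtain ⟨r, -, hr⟩ := (hasBasis_cobounded_norm (E := E3)).eventually_iff.1 hC.bound
  refine ⟨C, r, hC0, fun y hy ↦ ?_⟩
  have h1 := hr (show y ∈ {x : E3 | r ≤ ‖x‖} from hy)
  rw [Real.norm_of_nonneg (Real.rpow_nonneg (norm_nonneg _) _)] at h1
  exact (le_abs_self _).trans ((Real.norm_eq_abs _).symm.le.trans h1)

/-- **The scalar jet function is Lipschitz near the flat jet `(δ, 0, 0)`**: there are `ρ > 0`
and `M ≥ 0` such that the jet function `𝓢(A, D₁, D₂) = tr (A⁻¹ ∘ ricciJet (0, A, D₁, D₂))`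
(`scalAt_eq_scalarJet`) satisfies `|𝓢(A', D₁', D₂') − 𝓢(A, D₁, D₂)| ≤ M max(‖A' − A‖, ‖D₁' − D₁‖,
‖D₂' − D₂‖)` whenever both jets are `ρ`-close to `(δ, 0, 0)` (a `C¹` function is Lipschitz near a
point, `ContDiffAt.exists_lipschitzOnWith`; `contDiffOn_scalarJet`, `δ` is invertible). [folklore] -/
theorem exists_lipschitz_scalarJet_near_flat :
    ∃ ρ M : ℝ, 0 < ρ ∧ 0 ≤ M ∧
      ∀ (A A' : E3 →L[ℝ] E3 →L[ℝ] ℝ) (B B' : E3 →L[ℝ] E3 →L[ℝ] E3 →L[ℝ] ℝ)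
        (T T' : E3 →L[ℝ] E3 →L[ℝ] E3 →L[ℝ] E3 →L[ℝ] ℝ),
        ‖A - (innerSL ℝ : E3 →L[ℝ] E3 →L[ℝ] ℝ)‖ < ρ → ‖B‖ < ρ → ‖T‖ < ρ →
        ‖A' - (innerSL ℝ : E3 →L[ℝ] E3 →L[ℝ] ℝ)‖ < ρ → ‖B'‖ < ρ → ‖T'‖ < ρ →
        |MetricCoord.traceCLM E3 (A'.inverse.comp (MetricCoord.ricciJet ((0 : E3), A', B', T'))) -
            MetricCoord.traceCLM E3 (A.inverse.comp (MetricCoord.ricciJet ((0 : E3), A, B, T)))| ≤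
          M * max ‖A' - A‖ (max ‖B' - B‖ ‖T' - T‖) := by
  set 𝓢 : (E3 →L[ℝ] E3 →L[ℝ] ℝ) × (E3 →L[ℝ] E3 →L[ℝ] E3 →L[ℝ] ℝ) ×
      (E3 →L[ℝ] E3 →L[ℝ] E3 →L[ℝ] E3 →L[ℝ] ℝ) → ℝ := fun q ↦
    MetricCoord.traceCLM E3 (q.1.inverse.comp (MetricCoord.ricciJet ((0 : E3), q.1, q.2.1, q.2.2)))
    with h𝓢
  set j₀ : (E3 →L[ℝ] E3 →L[ℝ] ℝ) × (E3 →L[ℝ] E3 →L[ℝ] E3 →L[ℝ] ℝ) ×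
      (E3 →L[ℝ] E3 →L[ℝ] E3 →L[ℝ] E3 →L[ℝ] ℝ) :=
    ((innerSL ℝ : E3 →L[ℝ] E3 →L[ℝ] ℝ), 0, 0) with hj₀
  have hΩo := MetricCoord.isOpen_scalarJetDomain (E := E3)
  have h𝓢s : ContDiffOn ℝ ∞ 𝓢 {q | q.1.IsInvertible} := MetricCoord.contDiffOn_scalarJet (E := E3)
  have hδinv : (innerSL ℝ : E3 →L[ℝ] E3 →L[ℝ] ℝ).IsInvertible := by
    refine MetricCoord.isInvertible_of_nondegenerate fun v hv ↦ ?_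
    have h := hv v
    rw [innerSL_apply_apply] at h
    exact inner_self_eq_zero.1 h
  have hj₀Ω : j₀ ∈ {q : (E3 →L[ℝ] E3 →L[ℝ] ℝ) × (E3 →L[ℝ] E3 →L[ℝ] E3 →L[ℝ] ℝ) ×
      (E3 →L[ℝ] E3 →L[ℝ] E3 →L[ℝ] E3 →L[ℝ] ℝ) | q.1.IsInvertible} := hδinv
  have h1 : ContDiffAt ℝ 1 𝓢 j₀ :=
    (h𝓢s.contDiffAt (hΩo.mem_nhds hj₀Ω)).of_le (by exact_mod_cast le_top)
  obtain ⟨K, t, ht, hK⟩ := h1.exists_lipschitzOnWith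
  obtain ⟨ε, hε, hεt⟩ := Metric.mem_nhds_iff.1 ht
  refine ⟨ε, K, hε, K.coe_nonneg, fun A A' B B' T T' hA hB hT hA' hB' hT' ↦ ?_⟩
  have hmem : ∀ (A₁ : E3 →L[ℝ] E3 →L[ℝ] ℝ) (B₁ : E3 →L[ℝ] E3 →L[ℝ] E3 →L[ℝ] ℝ)
      (T₁ : E3 →L[ℝ] E3 →L[ℝ] E3 →L[ℝ] E3 →L[ℝ] ℝ),
      ‖A₁ - (innerSL ℝ : E3 →L[ℝ] E3 →L[ℝ] ℝ)‖ < ε → ‖B₁‖ < ε → ‖T₁‖ < ε →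
      ((A₁, B₁, T₁) : (E3 →L[ℝ] E3 →L[ℝ] ℝ) × (E3 →L[ℝ] E3 →L[ℝ] E3 →L[ℝ] ℝ) ×
        (E3 →L[ℝ] E3 →L[ℝ] E3 →L[ℝ] E3 →L[ℝ] ℝ)) ∈ t := by
    intro A₁ B₁ T₁ h₁ h₂ h₃
    refine hεt ?_
    rw [mem_ball_iff_norm]
    have hsub : ((A₁, B₁, T₁) : (E3 →L[ℝ] E3 →L[ℝ] ℝ) × (E3 →L[ℝ] E3 →L[ℝ] E3 →L[ℝ] ℝ) ×
        (E3 →L[ℝ] E3 →L[ℝ] E3 →L[ℝ] E3 →L[ℝ] ℝ)) - j₀ =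
        (A₁ - (innerSL ℝ : E3 →L[ℝ] E3 →L[ℝ] ℝ), B₁, T₁) := by
      simp only [hj₀, Prod.mk_sub_mk, sub_zero]
    rw [hsub, Prod.norm_mk, Prod.norm_mk]
    exact max_lt h₁ (max_lt h₂ h₃)
  have hd := (lipschitzOnWith_iff_norm_sub_le.1 hK) (hmem A' B' T' hA' hB' hT') (hmem A B T hA hB hT)
  rw [Real.norm_eq_abs] at hd
  have hsub : ((A', B', T') : (E3 →L[ℝ] E3 →L[ℝ] ℝ) × (E3 →L[ℝ] E3 →L[ℝ] E3 →L[ℝ] ℝ) ×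
        (E3 →L[ℝ] E3 →L[ℝ] E3 →L[ℝ] E3 →L[ℝ] ℝ)) - (A, B, T) = (A' - A, B' - B, T' - T) := by
    simp only [Prod.mk_sub_mk]
  rw [hsub, Prod.norm_mk, Prod.norm_mk] at hd
  exact hd

/-- **The jets of the end: `J_h(y) → (δ, 0, 0)` and `‖J_Ric(y)‖ ≤ C ‖y‖⁻⁴`.** For data with
`h − δ = o₅(r⁻²)`: `ricciCoeff e D` is smooth beyond some `R₀ ≥ R`; its value and first two
derivatives are `≤ C ‖y‖⁻⁴` far out (`ricciCoeff ∈ O₃(r⁻⁴)`, `isBigOSmooth_ricciCoeff`); and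
`hCoeff e D − δ` and its first two derivatives tend to `0` (`h − δ = O₅(r⁻²)`). [folklore] -/
theorem exists_jet_bounds_of_isStronglyAsymptoticallyFlatWith [D.metric.HasLeviCivita]
    (haf : e.IsStronglyAsymptoticallyFlatWith D 0 2 0 5 0) {η : ℝ} (hη : 0 < η) :
    ∃ R₀ C r : ℝ, e.R ≤ R₀ ∧ 0 ≤ C ∧ ContDiffOn ℝ ∞ (ricciCoeff e D) {y : E3 | R₀ < ‖y‖} ∧
      ∀ y : E3, r ≤ ‖y‖ →
        R₀ < ‖y‖ ∧ ‖ricciCoeff e D y‖ ≤ C * ‖y‖ ^ (-4 : ℝ) ∧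
        ‖fderiv ℝ (ricciCoeff e D) y‖ ≤ C * ‖y‖ ^ (-4 : ℝ) ∧
        ‖fderiv ℝ (fderiv ℝ (ricciCoeff e D)) y‖ ≤ C * ‖y‖ ^ (-4 : ℝ) ∧
        ‖hCoeff e D y - (innerSL ℝ : E3 →L[ℝ] E3 →L[ℝ] ℝ)‖ < η ∧ ‖fderiv ℝ (hCoeff e D) y‖ < η ∧
        ‖fderiv ℝ (fderiv ℝ (hCoeff e D)) y‖ < η ∧ C * ‖y‖ ^ (-4 : ℝ) ≤ η := by
  -- the symbols `H − δ ∈ O₅(r⁻²)`, `P ∈ O₃(r⁻⁴)`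
  have hH : IsBigOSmooth 5 (-2) fun y ↦ hCoeff e D y - (innerSL ℝ : E3 →L[ℝ] E3 →L[ℝ] ℝ) :=
    e.isBigOSmooth_hCoeff_sub_innerSL D haf
  have hP : IsBigOSmooth 3 (-2 - 2) (ricciCoeff e D) :=
    e.isBigOSmooth_ricciCoeff D (k := 3) (β := 2) hH two_pos
  obtain ⟨R₀', hP's⟩ := hP.1
  set R₀ : ℝ := max e.R R₀' with hR₀
  have hPs : ContDiffOn ℝ ∞ (ricciCoeff e D) {y : E3 | R₀ < ‖y‖} :=
    hP's.mono fun y hy ↦ show R₀' < ‖y‖ from lt_of_le_of_lt (le_max_right _ _) hy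
  -- derivatives of the symbols
  have hH1 : IsBigOSmooth 4 (-2 - 1) (fderiv ℝ (hCoeff e D)) :=
    (hH.fderiv (k := 4)).congr fun y ↦ by rw [fderiv_sub_const]
  have hH2 : IsBigOSmooth 3 (-2 - 1 - 1) (fderiv ℝ (fderiv ℝ (hCoeff e D))) := hH1.fderiv (k := 3)
  have hP1 : IsBigOSmooth 2 (-2 - 2 - 1) (fderiv ℝ (ricciCoeff e D)) := hP.fderiv (k := 2)
  have hP2 : IsBigOSmooth 1 (-2 - 2 - 1 - 1) (fderiv ℝ (fderiv ℝ (ricciCoeff e D))) :=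
    hP1.fderiv (k := 1)
  have hr : ∀ a : ℝ, a < 0 → Tendsto (fun y : E3 ↦ ‖y‖ ^ a) (cobounded E3) (𝓝 0) := fun a ha ↦ by
    have h := (tendsto_rpow_neg_atTop (by linarith : (0 : ℝ) < -a)).comp
      (tendsto_norm_cobounded_atTop (E := E3))
    refine h.congr fun y ↦ ?_
    simp
  -- `J_h(y) → (δ, 0, 0)`
  have hT0 : Tendsto (fun y ↦ ‖hCoeff e D y - (innerSL ℝ : E3 →L[ℝ] E3 →L[ℝ] ℝ)‖) (cobounded E3)
      (𝓝 0) := by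
    have h := hH.isBigO (m := 0) (by norm_num)
    simp only [norm_iteratedFDeriv_zero, Nat.cast_zero, sub_zero] at h
    exact h.trans_tendsto (hr _ (by norm_num))
  have hT1 : Tendsto (fun y ↦ ‖fderiv ℝ (hCoeff e D) y‖) (cobounded E3) (𝓝 0) := by
    have h := hH1.isBigO (m := 0) (by norm_num)
    simp only [norm_iteratedFDeriv_zero, Nat.cast_zero, sub_zero] at h
    exact h.trans_tendsto (hr _ (by norm_num))
  have hT2 : Tendsto (fun y ↦ ‖fderiv ℝ (fderiv ℝ (hCoeff e D)) y‖) (cobounded E3) (𝓝 0) := by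
    have h := hH2.isBigO (m := 0) (by norm_num)
    simp only [norm_iteratedFDeriv_zero, Nat.cast_zero, sub_zero] at h
    exact h.trans_tendsto (hr _ (by norm_num))
  -- `‖J_Ric(y)‖ ≤ C ‖y‖⁻⁴`
  have hB0 : (fun y ↦ ‖ricciCoeff e D y‖) =O[cobounded E3] fun y ↦ ‖y‖ ^ (-4 : ℝ) := by
    have h := hP.isBigO (m := 0) (by norm_num)
    simp only [norm_iteratedFDeriv_zero, Nat.cast_zero, sub_zero] at h
    exact h.congr_right fun y ↦ by norm_num
  have hB1 : (fun y ↦ ‖fderiv ℝ (ricciCoeff e D) y‖) =O[cobounded E3] fun y ↦ ‖y‖ ^ (-4 : ℝ) := by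
    have h := hP1.isBigO (m := 0) (by norm_num)
    simp only [norm_iteratedFDeriv_zero, Nat.cast_zero, sub_zero] at h
    exact (h.congr_right fun y ↦ show _ = ‖y‖ ^ (-5 : ℝ) by norm_num).trans
      (isBigO_norm_rpow_rpow_cobounded (by norm_num))
  have hB2 : (fun y ↦ ‖fderiv ℝ (fderiv ℝ (ricciCoeff e D)) y‖) =O[cobounded E3]
      fun y ↦ ‖y‖ ^ (-4 : ℝ) := by
    have h := hP2.isBigO (m := 0) (by norm_num)
    simp only [norm_iteratedFDeriv_zero, Nat.cast_zero, sub_zero] at h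
    exact (h.congr_right fun y ↦ show _ = ‖y‖ ^ (-6 : ℝ) by norm_num).trans
      (isBigO_norm_rpow_rpow_cobounded (by norm_num))
  obtain ⟨C₀, r₀, hC₀, hC₀b⟩ := exists_radius_le_of_isBigO hB0
  obtain ⟨C₁, r₁, hC₁, hC₁b⟩ := exists_radius_le_of_isBigO hB1
  obtain ⟨C₂, r₂, hC₂, hC₂b⟩ := exists_radius_le_of_isBigO hB2
  set C : ℝ := max C₀ (max C₁ C₂) with hC
  have hC0 : 0 ≤ C := hC₀.trans (le_max_left _ _)
  have hev : ∀ᶠ y in cobounded E3, R₀ < ‖y‖ ∧ r₀ ≤ ‖y‖ ∧ r₁ ≤ ‖y‖ ∧ r₂ ≤ ‖y‖ ∧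
      ‖hCoeff e D y - (innerSL ℝ : E3 →L[ℝ] E3 →L[ℝ] ℝ)‖ < η ∧ ‖fderiv ℝ (hCoeff e D) y‖ < η ∧
      ‖fderiv ℝ (fderiv ℝ (hCoeff e D)) y‖ < η ∧ C * ‖y‖ ^ (-4 : ℝ) ≤ η := by
    have h8 : ∀ᶠ y in cobounded E3, C * ‖y‖ ^ (-4 : ℝ) ≤ η := by
      have h := ((hr (-4) (by norm_num)).const_mul C)
      rw [mul_zero] at h
      exact h.eventually (ge_mem_nhds hη)
    filter_upwards [eventually_cobounded_lt_norm R₀,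
      (hasBasis_cobounded_norm (E := E3)).mem_of_mem (i := r₀) trivial,
      (hasBasis_cobounded_norm (E := E3)).mem_of_mem (i := r₁) trivial,
      (hasBasis_cobounded_norm (E := E3)).mem_of_mem (i := r₂) trivial,
      hT0.eventually (gt_mem_nhds hη), hT1.eventually (gt_mem_nhds hη),
      hT2.eventually (gt_mem_nhds hη), h8] with y h1 h2 h3 h4 h5 h6 h7 h8'
    exact ⟨h1, h2, h3, h4, h5, h6, h7, h8'⟩
  obtain ⟨r, -, hr'⟩ := (hasBasis_cobounded_norm (E := E3)).eventually_iff.1 hev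
  refine ⟨R₀, C, r, le_max_left _ _, hC0, hPs, fun y hy ↦ ?_⟩
  obtain ⟨h1, h2, h3, h4, h5, h6, h7, h8⟩ := hr' (show y ∈ {x : E3 | r ≤ ‖x‖} from hy)
  have hr4 : 0 ≤ ‖y‖ ^ (-4 : ℝ) := Real.rpow_nonneg (norm_nonneg _) _
  refine ⟨h1, (hC₀b y h2).trans (mul_le_mul_of_nonneg_right (le_max_left _ _) hr4),
    (hC₁b y h3).trans (mul_le_mul_of_nonneg_right ((le_max_left _ _).trans (le_max_right _ _)) hr4),
    (hC₂b y h4).trans (mul_le_mul_of_nonneg_right ((le_max_right _ _).trans (le_max_right _ _)) hr4),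
    h5, h6, h7, h8⟩

/-- **Uniform decay of the scalar curvatures of `ds²_t = ds² + t Ric` on the end**
(Schoen–Yau 1979, p. 73, (3.28)–(3.29): the hypotheses (3.3) and the difference quotients of
`R_t` are controlled uniformly for `t` small). For data `D` with `h − δ = o₅(r⁻²)` on the end `e`
there are `R₁ > R` and `K ≥ 0` such that for every `|t| ≤ 1` and all data `D₂` whose metric is
`h + t Ric(h)` pointwise, `|R(D₂)(x) − R(h)(x)| ≤ |t| K ‖coord x‖⁻⁴` on `far R₁`. Proof in the
module docstring (smooth jet function, affine segment of jets, mean value inequality on a compact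
convex neighbourhood of the flat jet `(δ, 0, 0)`). [cite: SchoenYauPMT1979, (3.28)–(3.29) (p. 73)] -/
theorem exists_far_abs_scalarCurvature_ricciFamily_sub_le [D.metric.HasLeviCivita]
    (haf : e.IsStronglyAsymptoticallyFlatWith D 0 2 0 5 0) :
    ∃ R₁ K : ℝ, e.R < R₁ ∧ 0 ≤ K ∧
      ∀ (D₂ : InitialDataSet (𝓡 3) X) (t : ℝ), |t| ≤ 1 →
        (∀ (x : X) (v w : TangentSpace (𝓡 3) x),
          D₂.metric.val x v w = D.metric.val x v w + t * D.metric.ricci x v w) →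
        ∀ x ∈ e.far R₁,
          |D₂.scalarCurvatureFn x - D.scalarCurvatureFn x| ≤ |t| * K * ‖e.coord x‖ ^ (-4 : ℝ) := by
  obtain ⟨ρ, M, hρ, hM0, hM⟩ := exists_lipschitz_scalarJet_near_flat
  obtain ⟨R₀, C, r, hRR₀, hC0, hPs, hfar⟩ :=
    e.exists_jet_bounds_of_isStronglyAsymptoticallyFlatWith D haf (half_pos hρ)
  set R₁ : ℝ := max r (e.R + 1) with hR₁
  have hRR₁ : e.R < R₁ := by
    have : e.R + 1 ≤ R₁ := le_max_right _ _
    linarith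
  refine ⟨R₁, M * C, hRR₁, mul_nonneg hM0 hC0, fun D₂ t ht hD₂ x hx ↦ ?_⟩
  -- the point `x = Φ z`, `‖z‖ > R₁`
  obtain ⟨z, hz, rfl⟩ := e.mem_far_iff.1 hx
  have hyR : e.R < ‖(z : E3)‖ := z.2
  obtain ⟨hy0, hP0, hP1, hP2, hH0, hH1, hH2, hyC⟩ := hfar z ((le_max_left _ _).trans hz.le)
  rw [e.coord_dataChart z]
  have hr4 : 0 ≤ ‖(z : E3)‖ ^ (-4 : ℝ) := Real.rpow_nonneg (norm_nonneg _) _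
  have hρ2 : C * ‖(z : E3)‖ ^ (-4 : ℝ) ≤ ρ / 2 := hyC
  -- the jets of `hCoeff e D₂` at `z`
  have hG0 : hCoeff e D₂ z = hCoeff e D z + t • ricciCoeff e D z := e.hCoeff_eq_add_ricciCoeff D hD₂ z
  have hG1 : fderiv ℝ (hCoeff e D₂) z = fderiv ℝ (hCoeff e D) z + t • fderiv ℝ (ricciCoeff e D) z :=
    e.fderiv_hCoeff_ricciFamily D hD₂ hRR₀ hPs hy0
  have hG2 : fderiv ℝ (fderiv ℝ (hCoeff e D₂)) z =
      fderiv ℝ (fderiv ℝ (hCoeff e D)) z + t • fderiv ℝ (fderiv ℝ (ricciCoeff e D)) z :=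
    e.fderiv_fderiv_hCoeff_ricciFamily D hD₂ hRR₀ hPs hy0
  -- the scalar curvatures through the jet function
  have hS₂ : D₂.scalarCurvatureFn (e.dataChart z) =
      MetricCoord.traceCLM E3 ((hCoeff e D₂ z).inverse.comp (MetricCoord.ricciJet
        ((0 : E3), hCoeff e D₂ z, fderiv ℝ (hCoeff e D₂) z, fderiv ℝ (fderiv ℝ (hCoeff e D₂)) z))) := by
    rw [← e.scalAt_hCoeff_eq D₂ hyR, MetricCoord.scalAt_eq_scalarJet (e.isMetricOn_hCoeff D₂) hyR]
  have hS : D.scalarCurvatureFn (e.dataChart z) =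
      MetricCoord.traceCLM E3 ((hCoeff e D z).inverse.comp (MetricCoord.ricciJet
        ((0 : E3), hCoeff e D z, fderiv ℝ (hCoeff e D) z, fderiv ℝ (fderiv ℝ (hCoeff e D)) z))) := by
    rw [← e.scalAt_hCoeff_eq D hyR, MetricCoord.scalAt_eq_scalarJet (e.isMetricOn_hCoeff D) hyR]
  -- the perturbations `t • (jet of ricciCoeff)` are `≤ |t| C ‖z‖⁻⁴ ≤ ρ/2` in norm
  have hsm : ∀ {W : Type} [NormedAddCommGroup W] [NormedSpace ℝ W] (w : W),
      ‖w‖ ≤ C * ‖(z : E3)‖ ^ (-4 : ℝ) → ‖t • w‖ ≤ |t| * (C * ‖(z : E3)‖ ^ (-4 : ℝ)) ∧ ‖t • w‖ ≤ ρ / 2 := by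
    intro W _ _ w hw
    rw [norm_smul, Real.norm_eq_abs]
    have h1 : |t| * ‖w‖ ≤ |t| * (C * ‖(z : E3)‖ ^ (-4 : ℝ)) := mul_le_mul_of_nonneg_left hw (abs_nonneg t)
    refine ⟨h1, h1.trans ?_⟩
    calc |t| * (C * ‖(z : E3)‖ ^ (-4 : ℝ)) ≤ 1 * (C * ‖(z : E3)‖ ^ (-4 : ℝ)) :=
          mul_le_mul_of_nonneg_right ht (mul_nonneg hC0 hr4)
      _ ≤ ρ / 2 := by rw [one_mul]; exact hρ2
  obtain ⟨ht0, ht0'⟩ := hsm (ricciCoeff e D z) hP0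
  obtain ⟨ht1, ht1'⟩ := hsm (fderiv ℝ (ricciCoeff e D) z) hP1
  obtain ⟨ht2, ht2'⟩ := hsm (fderiv ℝ (fderiv ℝ (ricciCoeff e D)) z) hP2
  -- closeness of both jets to the flat jet
  have hA' : ‖hCoeff e D₂ z - (innerSL ℝ : E3 →L[ℝ] E3 →L[ℝ] ℝ)‖ < ρ := by
    rw [hG0, show hCoeff e D z + t • ricciCoeff e D z - (innerSL ℝ : E3 →L[ℝ] E3 →L[ℝ] ℝ) =
      (hCoeff e D z - (innerSL ℝ : E3 →L[ℝ] E3 →L[ℝ] ℝ)) + t • ricciCoeff e D z by abel]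
    refine (norm_add_le _ _).trans_lt ?_
    linarith
  have hB' : ‖fderiv ℝ (hCoeff e D₂) z‖ < ρ := by
    rw [hG1]
    refine (norm_add_le _ _).trans_lt ?_
    linarith
  have hT' : ‖fderiv ℝ (fderiv ℝ (hCoeff e D₂)) z‖ < ρ := by
    rw [hG2]
    refine (norm_add_le _ _).trans_lt ?_
    linarith
  -- the Lipschitz bound
  have hkey := hM (hCoeff e D z) (hCoeff e D₂ z) (fderiv ℝ (hCoeff e D) z) (fderiv ℝ (hCoeff e D₂) z)
    (fderiv ℝ (fderiv ℝ (hCoeff e D)) z) (fderiv ℝ (fderiv ℝ (hCoeff e D₂)) z)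
    (by linarith) (by linarith) (by linarith) hA' hB' hT'
  rw [hS₂, hS]
  refine hkey.trans ?_
  have hmax : max ‖hCoeff e D₂ z - hCoeff e D z‖ (max ‖fderiv ℝ (hCoeff e D₂) z - fderiv ℝ (hCoeff e D) z‖
      ‖fderiv ℝ (fderiv ℝ (hCoeff e D₂)) z - fderiv ℝ (fderiv ℝ (hCoeff e D)) z‖) ≤
      |t| * (C * ‖(z : E3)‖ ^ (-4 : ℝ)) := by
    rw [hG0, hG1, hG2, add_sub_cancel_left, add_sub_cancel_left, add_sub_cancel_left]
    exact max_le ht0 (max_le ht1 ht2)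
  calc M * max ‖hCoeff e D₂ z - hCoeff e D z‖ (max ‖fderiv ℝ (hCoeff e D₂) z - fderiv ℝ (hCoeff e D) z‖
        ‖fderiv ℝ (fderiv ℝ (hCoeff e D₂)) z - fderiv ℝ (fderiv ℝ (hCoeff e D)) z‖)
      ≤ M * (|t| * (C * ‖(z : E3)‖ ^ (-4 : ℝ))) := mul_le_mul_of_nonneg_left hmax hM0
    _ = |t| * (M * C) * ‖(z : E3)‖ ^ (-4 : ℝ) := by ring

end AFEnd

end Literature.Geometry.Lorentzian

end
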